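import Literature.AlgebraicGeometry.Motives.HodgeStructureWeil
import Literature.AlgebraicGeometry.Motives.HodgeStructureK3TypeAdjointProofs
import Mathlib.LinearAlgebra.Matrix.BilinearForm
import HarnessLib

/-!
# The weight-one Hodge structure of a period `τ` on `ℚ²` and its endomorphisms

For `τ ∈ ℂ ∖ ℝ` the complex torus `E_τ = ℂ/(ℤ + τℤ)` has `H¹(E_τ; ℚ) = ℚ²` with `H¹ ⊗ ℂ = ℂ ω_τ ⊕ ℂ ω̄_τ`,
`ω_τ = (1, τ)` (Lange–Birkenhake §1.2, Thm. 4.2.1).  This file builds that weight-one `ℚ`-Hodge structure `V¹_τ`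
ABSTRACTLY on `ℚ²`, as the tree's two-type structure `HodgeStructure.ofSplitting (ℂ ∙ ω) hP one_pos` of the
splitting `ℂ ⊗_ℚ ℚ² = ℂ ω ⊕ ℂ ω̄` for ANY vector `ω ∈ ℂ ⊗_ℚ ℚ²` with coordinates `(1, τ)` (coordinates through
Mathlib's `TensorProduct.piScalarRight ℚ ℂ ℂ (Fin 2) : ℂ ⊗_ℚ ℚ² ≃ ℂ²`; hypotheses `h0`, `h1` below), polarises it
for `Im τ > 0` by the symplectic form `E(x, y) = x₀ y₁ − x₁ y₀` = `Matrix.toBilin' (0 1; -1 0)` (Riemann's bilinear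
relations: `E_ℂ(ω, ω) = 0`, `i E_ℂ(a ω, conj(a ω)) = 2 Im τ |a|² > 0`), and computes its endomorphisms: a
`ℚ`-linear `M` preserving `F¹ = ℂ ω` satisfies `m₀₁ τ² + (m₀₀ − m₁₁) τ − m₁₀ = 0`, so **`End(V¹_τ) = ℚ` as soon as
`τ` satisfies no rational quadratic equation** (Moonen–Zarhin 1999 §2, `g = 1`: Type I(1) `End⁰ = ℚ` versus Type
IV(1,1) = CM, the latter iff `[ℚ(τ) : ℚ] = 2`).  Notation-free export: `exists_weightOne_rankTwo_hom_eq_smul_of` —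
**for such `τ` a polarisable, effective `ℚ`-Hodge structure of weight one on `ℚ²` all of whose endomorphisms are
rational scalars exists.**  By Riemann's theorem (essential image, PROVED in `CorCM/Geometry/RiemannEssentialImage`)
it is `H¹_B` of an elliptic curve without complex multiplication — that step, with `τ₀ = √2 + i`, is
`Assembly/NonCMEllipticCurveExists`.

References: [LangeBirkenhake1992] §1.2, Thm. 4.2.1, §4.2 · [MoonenZarhin1999LowDim] Math. Ann. 315 (1999), §2
(`g = 1`) · [CarlsonMullerStachPeters2017] §3.5 eq. (3.5) · [VoisinHodgeI2002] §7.1.2 Def. 7.7 ·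
[DeligneHodgeII1971] 1.2.5, 2.1.15.

Provenance: Literature home (family `hodge`) of the Summits-side `CorCM/Geometry/WeightOneHodgeStructureOfPeriod` (cell `pub-hodgecm2`, COR-CM assembly; all its imports are `Literature/` but the chain itself), which `Literature/` may not import; theorems only, no named fact, no definition. Nothing here bears on `HC_CM`; no case of the Hodge conjecture is proved. Lane `lit-hodgefound` (Layer A1/A3: weight-one Hodge structures, CM and non-CM elliptic curves), seat p20.
-/

noncomputable section

open scoped TensorProduct
open Module TensorProduct
open Literature.AlgebraicGeometry.Motives
open Literature.AlgebraicGeometry.Motives.HodgeStructure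

namespace Literature.AlgebraicGeometry.Motives.PeriodHodgeStructure

/-! ## §1 Coordinates on `ℂ ⊗_ℚ ℚ²` -/

/-- Coordinates `ℂ ⊗_ℚ (Fin 2 → ℚ) ≃ (Fin 2 → ℂ)`: `(z ⊗ v)_i = v i · z` (Mathlib's `TensorProduct.piScalarRight`).
 [cite: LangeBirkenhake1992, §1.2 and §4.2 Thm. 4.2.1] -/
theorem coords_tmul (z : ℂ) (v : Fin 2 → ℚ) (i : Fin 2) :
    piScalarRight ℚ ℂ ℂ (Fin 2) (z ⊗ₜ[ℚ] v) i = (v i : ℂ) * z := by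
  simp [TensorProduct.piScalarRight_apply, Rat.smul_def]

/-- Complex conjugation `conj (z ⊗ v) = z̄ ⊗ v` acts on coordinates coordinatewise. [cite: LangeBirkenhake1992, §1.2 and §4.2 Thm. 4.2.1] -/
theorem coords_conj (x : ℂ ⊗[ℚ] (Fin 2 → ℚ)) (i : Fin 2) :
    piScalarRight ℚ ℂ ℂ (Fin 2) (conj x) i = starRingEnd ℂ (piScalarRight ℚ ℂ ℂ (Fin 2) x i) := by
  induction x using TensorProduct.induction_on with
  | zero => simp
  | tmul z v => rw [conj_tmul, coords_tmul, coords_tmul, map_mul, map_ratCast]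
  | add x y hx hy => rw [map_add, map_add, Pi.add_apply, hx, hy, map_add, Pi.add_apply, map_add]

/-- The conjugate of a line `ℂ ω` is the line `ℂ ω̄`. [cite: LangeBirkenhake1992, §1.2 and §4.2 Thm. 4.2.1] -/
theorem complexConj_span_singleton (ω : ℂ ⊗[ℚ] (Fin 2 → ℚ)) :
    complexConj (ℂ ∙ ω) = ℂ ∙ conj ω := by
  ext x
  rw [mem_complexConj, Submodule.mem_span_singleton, Submodule.mem_span_singleton]
  constructor
  · rintro ⟨c, hc⟩
    refine ⟨starRingEnd ℂ c, ?_⟩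
    have h := congrArg conj hc
    rwa [conj_smul, conj_conj] at h
  · rintro ⟨c, rfl⟩
    exact ⟨starRingEnd ℂ c, by rw [conj_smul, conj_conj]⟩

/-! ## §2 A period vector `ω` with coordinates `(1, τ)`: the splitting `ℂ ⊗_ℚ ℚ² = ℂ ω ⊕ ℂ ω̄` -/

section Period

variable {τ : ℂ} {ω : ℂ ⊗[ℚ] (Fin 2 → ℚ)} (h0 : piScalarRight ℚ ℂ ℂ (Fin 2) ω 0 = 1)
  (h1 : piScalarRight ℚ ℂ ℂ (Fin 2) ω 1 = τ)

include h0 in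
/-- `ω̄` has coordinate `0` equal to `1`. [cite: LangeBirkenhake1992, §1.2 and §4.2 Thm. 4.2.1] -/
theorem coords_conj_zero : piScalarRight ℚ ℂ ℂ (Fin 2) (conj ω) 0 = 1 := by
  rw [coords_conj, h0, map_one]

include h1 in
/-- `ω̄` has coordinate `1` equal to `τ̄`. [cite: LangeBirkenhake1992, §1.2 and §4.2 Thm. 4.2.1] -/
theorem coords_conj_one : piScalarRight ℚ ℂ ℂ (Fin 2) (conj ω) 1 = starRingEnd ℂ τ := by
  rw [coords_conj, h1]

include h0 in
/-- Coordinate `0` of `a ω + b ω̄` is `a + b`. [cite: LangeBirkenhake1992, §1.2 and §4.2 Thm. 4.2.1] -/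
theorem coords_comb_zero (a b : ℂ) : piScalarRight ℚ ℂ ℂ (Fin 2) (a • ω + b • conj ω) 0 = a + b := by
  rw [map_add, map_smul, map_smul, Pi.add_apply, Pi.smul_apply, Pi.smul_apply, smul_eq_mul, smul_eq_mul,
    coords_conj_zero h0, h0, mul_one, mul_one]

include h1 in
/-- Coordinate `1` of `a ω + b ω̄` is `a τ + b τ̄`. [cite: LangeBirkenhake1992, §1.2 and §4.2 Thm. 4.2.1] -/
theorem coords_comb_one (a b : ℂ) :
    piScalarRight ℚ ℂ ℂ (Fin 2) (a • ω + b • conj ω) 1 = a * τ + b * starRingEnd ℂ τ := by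
  rw [map_add, map_smul, map_smul, Pi.add_apply, Pi.smul_apply, Pi.smul_apply, smul_eq_mul, smul_eq_mul,
    coords_conj_one h1, h1]

include h0 h1 in
/-- For `τ ∉ ℝ` the lines `ℂ ω` and `ℂ ω̄` are complementary in `ℂ ⊗_ℚ ℚ² ≅ ℂ²` (`(1, τ)` and `(1, τ̄)` form a basis).
 [cite: LangeBirkenhake1992, §1.2 and §4.2 Thm. 4.2.1] -/
theorem isCompl_span (hτ : τ.im ≠ 0) : IsCompl (ℂ ∙ ω) (complexConj (ℂ ∙ ω)) := by
  rw [complexConj_span_singleton]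
  have hd : τ - starRingEnd ℂ τ ≠ 0 := by
    rw [Complex.sub_conj]
    intro h
    apply hτ
    have := congrArg Complex.im h
    simpa using this
  constructor
  · rw [Submodule.disjoint_def]
    intro x hx hx'
    obtain ⟨a, rfl⟩ := Submodule.mem_span_singleton.1 hx
    obtain ⟨b, hb⟩ := Submodule.mem_span_singleton.1 hx'
    have hzero : a • ω + (-b) • conj ω = 0 := by rw [neg_smul, ← hb, add_neg_cancel]
    have e0 := congrArg (fun y => piScalarRight ℚ ℂ ℂ (Fin 2) y 0) hzero
    have e1 := congrArg (fun y => piScalarRight ℚ ℂ ℂ (Fin 2) y 1) hzero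
    simp only [coords_comb_zero h0, coords_comb_one h1, map_zero, Pi.zero_apply] at e0 e1
    have hab : b = a := by linear_combination -e0
    rw [hab] at e1
    have ha : a * (τ - starRingEnd ℂ τ) = 0 := by linear_combination e1
    rcases mul_eq_zero.1 ha with ha | ha
    · rw [ha, zero_smul]
    · exact absurd ha hd
  · rw [codisjoint_iff, eq_top_iff]
    rintro x -
    set x0 := piScalarRight ℚ ℂ ℂ (Fin 2) x 0
    set x1 := piScalarRight ℚ ℂ ℂ (Fin 2) x 1
    set a : ℂ := (x1 - x0 * starRingEnd ℂ τ) / (τ - starRingEnd ℂ τ) with ha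
    set b : ℂ := (x0 * τ - x1) / (τ - starRingEnd ℂ τ) with hb
    have hx : x = a • ω + b • conj ω := by
      apply (piScalarRight ℚ ℂ ℂ (Fin 2)).injective
      ext i
      fin_cases i
      · change x0 = piScalarRight ℚ ℂ ℂ (Fin 2) (a • ω + b • conj ω) 0
        rw [coords_comb_zero h0, ha, hb, ← add_div, eq_div_iff hd]
        ring
      · change x1 = piScalarRight ℚ ℂ ℂ (Fin 2) (a • ω + b • conj ω) 1
        rw [coords_comb_one h1, ha, hb, div_mul_eq_mul_div, div_mul_eq_mul_div, ← add_div, eq_div_iff hd]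
        ring
    rw [hx]
    exact Submodule.add_mem_sup (Submodule.smul_mem _ a (Submodule.mem_span_singleton_self _))
      (Submodule.smul_mem _ b (Submodule.mem_span_singleton_self _))

/-! ## §3 The Hodge structure `V¹_τ = ofSplitting (ℂ ω)`: filtration, pieces, effectivity -/

variable (hP : IsCompl (ℂ ∙ ω) (complexConj (ℂ ∙ ω)))

/-- `F¹ V¹_τ = ℂ ω`. [cite: LangeBirkenhake1992, §1.2 and §4.2 Thm. 4.2.1] -/
theorem F_one : (ofSplitting (ℂ ∙ ω) hP one_pos : HodgeStructure (Fin 2 → ℚ) 1).F 1 = ℂ ∙ ω := by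
  rw [ofSplitting_F, twoStepFiltration_of_pos_of_le _ one_pos le_rfl]

/-- `Fᵖ V¹_τ = ⊥` for `p ≥ 2`. [cite: LangeBirkenhake1992, §1.2 and §4.2 Thm. 4.2.1] -/
theorem F_of_two_le {p : ℤ} (hp : 2 ≤ p) :
    (ofSplitting (ℂ ∙ ω) hP one_pos : HodgeStructure (Fin 2 → ℚ) 1).F p = ⊥ := by
  rw [ofSplitting_F, twoStepFiltration_of_lt _ (by omega) (by omega)]

/-- `(V¹_τ)^{0,1} = ℂ ω̄`. [cite: LangeBirkenhake1992, §1.2 and §4.2 Thm. 4.2.1] -/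
theorem piece_zero_one : (ofSplitting (ℂ ∙ ω) hP one_pos : HodgeStructure (Fin 2 → ℚ) 1).piece 0 1 = ℂ ∙ conj ω := by
  rw [piece_ofSplitting_zero_self, complexConj_span_singleton]

/-- `V¹_τ` is effective (types `(1,0)`, `(0,1)` only). [cite: LangeBirkenhake1992, §1.2 and §4.2 Thm. 4.2.1] -/
theorem isEffective : (ofSplitting (ℂ ∙ ω) hP one_pos : HodgeStructure (Fin 2 → ℚ) 1).IsEffective := by
  intro p q hne
  by_contra h
  apply hne
  apply piece_ofSplitting_eq_bot
  · rintro ⟨rfl, rfl⟩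
    exact h ⟨zero_le_one, le_rfl⟩
  · rintro ⟨rfl, rfl⟩
    exact h ⟨le_rfl, zero_le_one⟩

/-! ## §4 The polarisation by the symplectic form `E = Matrix.toBilin' (0 1; -1 0)` (for `Im τ > 0`) -/

/-- `E(x, y) = x₀ y₁ - x₁ y₀` for the symplectic form (the intersection form on `H¹(ℂ/Λ; ℚ)`, Lange–Birkenhake §4.2).
 [cite: LangeBirkenhake1992, §1.2 and §4.2 Thm. 4.2.1] -/
theorem symplecticForm_apply (x y : Fin 2 → ℚ) :
    Matrix.toBilin' !![(0 : ℚ), 1; -1, 0] x y = x 0 * y 1 - x 1 * y 0 := by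
  rw [Matrix.toBilin'_apply']
  simp [Matrix.mulVec, Fin.sum_univ_two, dotProduct]
  ring

/-- The complexified symplectic form in coordinates: `E_ℂ(x, y) = x₀ y₁ - x₁ y₀`. [cite: LangeBirkenhake1992, §1.2 and §4.2 Thm. 4.2.1] -/
theorem symplecticForm_baseChange (x y : ℂ ⊗[ℚ] (Fin 2 → ℚ)) :
    LinearMap.BilinForm.baseChange ℂ (Matrix.toBilin' !![(0 : ℚ), 1; -1, 0]) x y =
      piScalarRight ℚ ℂ ℂ (Fin 2) x 0 * piScalarRight ℚ ℂ ℂ (Fin 2) y 1 -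
        piScalarRight ℚ ℂ ℂ (Fin 2) x 1 * piScalarRight ℚ ℂ ℂ (Fin 2) y 0 := by
  induction x using TensorProduct.induction_on with
  | zero => simp
  | tmul a v =>
    induction y using TensorProduct.induction_on with
    | zero => simp
    | tmul b w =>
      rw [LinearMap.BilinForm.baseChange_tmul, symplecticForm_apply, coords_tmul, coords_tmul, coords_tmul,
        coords_tmul, Rat.smul_def]
      push_cast
      ring
    | add y₁ y₂ e₁ e₂ =>
      rw [map_add, e₁, e₂, map_add, Pi.add_apply, Pi.add_apply]
      ring
  | add x₁ x₂ e₁ e₂ =>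
    rw [map_add, LinearMap.add_apply, e₁, e₂, map_add, Pi.add_apply, Pi.add_apply]
    ring

include h0 h1 in
/-- `E_ℂ(ω, ω) = 0`. [cite: LangeBirkenhake1992, §1.2 and §4.2 Thm. 4.2.1] -/
theorem symplecticForm_self : LinearMap.BilinForm.baseChange ℂ (Matrix.toBilin' !![(0 : ℚ), 1; -1, 0]) ω ω = 0 := by
  rw [symplecticForm_baseChange, h0, h1]
  ring

include h0 h1 in
/-- `E_ℂ(ω, ω̄) = τ̄ - τ`. [cite: LangeBirkenhake1992, §1.2 and §4.2 Thm. 4.2.1] -/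
theorem symplecticForm_self_conj :
    LinearMap.BilinForm.baseChange ℂ (Matrix.toBilin' !![(0 : ℚ), 1; -1, 0]) ω (conj ω) = starRingEnd ℂ τ - τ := by
  rw [symplecticForm_baseChange, h0, h1, coords_conj_zero h0, coords_conj_one h1]
  ring

include h0 h1 in
/-- `E_ℂ(ω̄, ω) = τ - τ̄`. [cite: LangeBirkenhake1992, §1.2 and §4.2 Thm. 4.2.1] -/
theorem symplecticForm_conj_self :
    LinearMap.BilinForm.baseChange ℂ (Matrix.toBilin' !![(0 : ℚ), 1; -1, 0]) (conj ω) ω = τ - starRingEnd ℂ τ := by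
  rw [symplecticForm_baseChange, h0, h1, coords_conj_zero h0, coords_conj_one h1]
  ring

/-- `i · ā · a · (τ̄ - τ) = 2 Im τ |a|²`. [cite: LangeBirkenhake1992, §1.2 and §4.2 Thm. 4.2.1] -/
theorem key_identity_one_zero (a τ : ℂ) :
    Complex.I * (starRingEnd ℂ a * (a * (starRingEnd ℂ τ - τ))) = ((2 * τ.im * Complex.normSq a : ℝ) : ℂ) := by
  rw [← mul_assoc (starRingEnd ℂ a), mul_comm (starRingEnd ℂ a) a, Complex.mul_conj]
  apply Complex.ext
  · simp [Complex.normSq_apply]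
    ring
  · simp [Complex.normSq_apply]

/-- `-i · ā · a · (τ - τ̄) = 2 Im τ |a|²`. [cite: LangeBirkenhake1992, §1.2 and §4.2 Thm. 4.2.1] -/
theorem key_identity_zero_one (a τ : ℂ) :
    -Complex.I * (starRingEnd ℂ a * (a * (τ - starRingEnd ℂ τ))) = ((2 * τ.im * Complex.normSq a : ℝ) : ℂ) := by
  rw [← mul_assoc (starRingEnd ℂ a), mul_comm (starRingEnd ℂ a) a, Complex.mul_conj]
  apply Complex.ext
  · simp [Complex.normSq_apply]
    ring
  · simp [Complex.normSq_apply]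

include h0 h1 in
/-- **The Riemann form polarises `V¹_τ` for `Im τ > 0`**: `E` is alternating, `F¹ = ℂ ω` is `E_ℂ`-isotropic, and
`i E_ℂ(a ω, conj (a ω)) = 2 Im τ |a|² > 0` (Riemann's bilinear relations for the lattice `ℤ + τℤ`).
[cite: LangeBirkenhake1992, Thm. 4.2.1 and §4.2 (Riemann relations)] [cite: VoisinHodgeI2002, §7.1.2 Def. 7.7] -/
theorem isPolarizable (hτ' : 0 < τ.im) :
    (ofSplitting (ℂ ∙ ω) hP one_pos : HodgeStructure (Fin 2 → ℚ) 1).IsPolarizable := by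
  refine ⟨{ form := Matrix.toBilin' !![(0 : ℚ), 1; -1, 0], flip_form := ?_, form_apply_eq_zero := ?_, pos := ?_ }⟩
  · refine LinearMap.ext fun x => LinearMap.ext fun y => ?_
    rw [Int.negOnePow_one, Units.val_neg, Units.val_one, LinearMap.smul_apply, LinearMap.smul_apply]
    change Matrix.toBilin' !![(0 : ℚ), 1; -1, 0] y x = _
    rw [symplecticForm_apply, symplecticForm_apply, neg_smul, one_smul]
    ring
  · intro p x hx y hy
    by_cases hp : p ≤ 0
    · rw [F_of_two_le hP (by omega)] at hy
      rw [(Submodule.mem_bot ℂ).1 hy, map_zero]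
    by_cases hp1 : p = 1
    · subst hp1
      rw [show (1 : ℤ) + 1 - 1 = 1 by norm_num, F_one hP] at hy
      rw [F_one hP] at hx
      obtain ⟨a, rfl⟩ := Submodule.mem_span_singleton.1 hx
      obtain ⟨b, rfl⟩ := Submodule.mem_span_singleton.1 hy
      simp only [map_smul, LinearMap.smul_apply, smul_eq_mul, symplecticForm_self h0 h1, mul_zero]
    · rw [F_of_two_le hP (by omega)] at hx
      rw [(Submodule.mem_bot ℂ).1 hx, map_zero, LinearMap.zero_apply]
  · intro p q hpq x hx hx0
    by_cases h10 : p = 1 ∧ q = 0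
    · obtain ⟨rfl, rfl⟩ := h10
      rw [piece_ofSplitting_self_zero] at hx
      obtain ⟨a, rfl⟩ := Submodule.mem_span_singleton.1 hx
      have ha : a ≠ 0 := by
        rintro rfl
        exact hx0 (zero_smul _ _)
      refine ⟨2 * τ.im * Complex.normSq a, mul_pos (mul_pos two_pos hτ') (Complex.normSq_pos.2 ha), ?_⟩
      rw [conj_smul]
      simp only [map_smul, LinearMap.smul_apply, smul_eq_mul, symplecticForm_self_conj h0 h1, zpow_one, zpow_zero,
        inv_one, mul_one]
      exact key_identity_one_zero a τ
    by_cases h01 : p = 0 ∧ q = 1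
    · obtain ⟨rfl, rfl⟩ := h01
      rw [piece_zero_one hP] at hx
      obtain ⟨a, rfl⟩ := Submodule.mem_span_singleton.1 hx
      have ha : a ≠ 0 := by
        rintro rfl
        exact hx0 (zero_smul _ _)
      refine ⟨2 * τ.im * Complex.normSq a, mul_pos (mul_pos two_pos hτ') (Complex.normSq_pos.2 ha), ?_⟩
      rw [conj_smul, conj_conj]
      simp only [map_smul, LinearMap.smul_apply, smul_eq_mul, symplecticForm_conj_self h0 h1, zpow_one, zpow_zero,
        one_mul, Complex.inv_I]
      exact key_identity_zero_one a τ
    · exact absurd ((Submodule.mem_bot ℂ).1 (piece_ofSplitting_eq_bot _ hP _ h10 h01 ▸ hx)) hx0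

/-! ## §5 Endomorphisms of `V¹_τ`: rational scalars unless `τ` satisfies a rational quadratic equation -/

include h0 h1 in
/-- **`End(V¹_τ) = ℚ` when `τ` satisfies no rational quadratic equation** (Moonen–Zarhin 1999 §2, `g = 1`,
Type I(1): `End⁰ = ℚ`; the torus `ℂ/(ℤ + τℤ)` has complex multiplication iff `[ℚ(τ) : ℚ] = 2`).  An endomorphism
`M` of the Hodge structure stabilises `F¹ = ℂ ω`; in coordinates `M_ℂ ω = (m₀₀ + m₀₁ τ, m₁₀ + m₁₁ τ) = λ (1, τ)`
forces `m₀₁ τ² + (m₀₀ - m₁₁) τ - m₁₀ = 0`, hence `M = m₀₀ · 1`.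
[cite: MoonenZarhin1999LowDim, §2 (g = 1), Type I(1)] [cite: LangeBirkenhake1992, §1.2 Prop. 1.2.3] -/
theorem hom_eq_smul (hq : ∀ a b c : ℚ, (a : ℂ) * τ ^ 2 + b * τ + c = 0 → a = 0 ∧ b = 0 ∧ c = 0)
    (S : Hom (ofSplitting (ℂ ∙ ω) hP one_pos : HodgeStructure (Fin 2 → ℚ) 1) (ofSplitting (ℂ ∙ ω) hP one_pos)) :
    ∃ r : ℚ, S.toLinearMap = r • LinearMap.id := by
  set M := S.toLinearMap with hM
  have hω : ω ∈ ℂ ∙ ω := Submodule.mem_span_singleton_self _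
  have hmem : M.baseChange ℂ ω ∈ ℂ ∙ ω := by
    have h := S.map_F_le 1 ⟨ω, (by rw [F_one hP]; exact hω), rfl⟩
    rwa [F_one hP] at h
  obtain ⟨l, hl⟩ := Submodule.mem_span_singleton.1 hmem
  -- `ω = 1 ⊗ e₀ + τ ⊗ e₁`, so `M_ℂ ω = 1 ⊗ M e₀ + τ ⊗ M e₁`
  have hωeq : ω = (1 : ℂ) ⊗ₜ[ℚ] Pi.single 0 1 + τ ⊗ₜ[ℚ] Pi.single 1 1 := by
    apply (piScalarRight ℚ ℂ ℂ (Fin 2)).injective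
    ext j
    rw [map_add, Pi.add_apply, coords_tmul, coords_tmul]
    fin_cases j
    · simpa using h0
    · simpa using h1
  have hc : ∀ j, piScalarRight ℚ ℂ ℂ (Fin 2) (M.baseChange ℂ ω) j =
      (M (Pi.single 0 1) j : ℂ) + (M (Pi.single 1 1) j : ℂ) * τ := by
    intro j
    rw [hωeq, map_add, LinearMap.baseChange_tmul, LinearMap.baseChange_tmul, map_add, Pi.add_apply,
      coords_tmul, coords_tmul, mul_one]
  have e0 := congrArg (fun y => piScalarRight ℚ ℂ ℂ (Fin 2) y 0) hl
  have e1 := congrArg (fun y => piScalarRight ℚ ℂ ℂ (Fin 2) y 1) hl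
  simp only [map_smul, Pi.smul_apply, smul_eq_mul, h0, h1, mul_one, hc] at e0 e1
  -- the quadratic relation
  have hrel : ((M (Pi.single 1 1) 0 : ℚ) : ℂ) * τ ^ 2 + ((M (Pi.single 0 1) 0 - M (Pi.single 1 1) 1 : ℚ) : ℂ) * τ +
      ((-M (Pi.single 0 1) 1 : ℚ) : ℂ) = 0 := by
    push_cast
    rw [e0] at e1
    linear_combination e1
  obtain ⟨h01, h00, h10⟩ := hq _ _ _ hrel
  refine ⟨M (Pi.single 0 1) 0, ?_⟩
  apply (Pi.basisFun ℚ (Fin 2)).ext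
  intro i
  rw [Pi.basisFun_apply, LinearMap.smul_apply, LinearMap.id_apply]
  ext j
  rw [Pi.smul_apply, smul_eq_mul]
  fin_cases i <;> fin_cases j
  · simp
  · simpa using h10
  · simpa using h01
  · simp only [Fin.mk_one, Fin.isValue, Pi.single_eq_same, mul_one]
    rw [sub_eq_zero] at h00
    exact h00.symm

end Period

/-! ## §6 Export -/

/-- **For `Im τ > 0` with `τ` satisfying no rational quadratic equation there is a polarisable, effective
weight-one `ℚ`-Hodge structure on `ℚ²` — `V¹_τ`, built on `ω = 1 ⊗ e₀ + τ ⊗ e₁` — all of whose endomorphisms are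
rational scalars** (Moonen–Zarhin 1999 §2 Type I(1): the general elliptic curve has `End⁰ = ℚ`).
[cite: MoonenZarhin1999LowDim, §2 (g = 1), Type I(1)] [cite: LangeBirkenhake1992, §1.2 and Thm. 4.2.1] -/
theorem exists_weightOne_rankTwo_hom_eq_smul_of {τ : ℂ} (hτ' : 0 < τ.im)
    (hq : ∀ a b c : ℚ, (a : ℂ) * τ ^ 2 + b * τ + c = 0 → a = 0 ∧ b = 0 ∧ c = 0) :
    ∃ H : HodgeStructure (Fin 2 → ℚ) 1, H.IsPolarizable ∧ H.IsEffective ∧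
      ∀ S : Hom H H, ∃ r : ℚ, S.toLinearMap = r • LinearMap.id := by
  have h0 : piScalarRight ℚ ℂ ℂ (Fin 2) ((1 : ℂ) ⊗ₜ[ℚ] (Pi.single 0 1 : Fin 2 → ℚ) + τ ⊗ₜ[ℚ] Pi.single 1 1) 0 = 1 := by
    rw [map_add, Pi.add_apply, coords_tmul, coords_tmul]
    simp
  have h1 : piScalarRight ℚ ℂ ℂ (Fin 2) ((1 : ℂ) ⊗ₜ[ℚ] (Pi.single 0 1 : Fin 2 → ℚ) + τ ⊗ₜ[ℚ] Pi.single 1 1) 1 = τ := by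
    rw [map_add, Pi.add_apply, coords_tmul, coords_tmul]
    simp
  exact ⟨ofSplitting _ (isCompl_span h0 h1 hτ'.ne') one_pos, isPolarizable h0 h1 _ hτ', isEffective _,
    hom_eq_smul h0 h1 _ hq⟩

end Literature.AlgebraicGeometry.Motives.PeriodHodgeStructure

end
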